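import Summits.CriticalPhenomena.PercolationContinuityZ3.Theorems.PercNearOneGluingNoHeavyLowerTailSunflowerAndrasfaiWindows
import HarnessLib

/-!
# `NoHeavyLowerTail` (crux stmt-CriticalPhenomena-4575), abstract sunflower cubic: the ANDRÁSFAI GRAPHS ARE A-SAFE, part 2b — colour changes, run lengths, and the existence of a light pair of adjacent runs

Support file (seat `prim-ineq-prove-1` gen 42; `--supports stmt-CriticalPhenomena-4575`).  No `sorry`, no named facts, standard axioms.
Memo: run/shared/lean/prim/prim-ineq-prove-1/FINDING-BLOWUP-prove1-g42.md §7 (the theorem and its proof).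

THE PROGRAMME (files `…SunflowerAndrasfai*`).  THEOREM (memo §7; `Arc.arcGraph_safe` in `…SunflowerAndrasfaiSafe`): for every `k`
the graph core of the Andrásfai graph (`arcGraph k` on `Fin (3k+2)`: adjacent iff in no common arc of `k+1` consecutive points) is
safe for every product measure — conjecture (And) of `…SunflowerAndrasfai`; hence (…SunflowerBlowup, …BlowupHom) so is the core
of every blow-up of an Andrásfai graph and of every maximal triangle-free graph homomorphic to one.  PROOF: polarisation
(`safe_arcGraph_of_colouring_ineq`, part 1b) reduces safety to `∏_j Λ(C_j) ≤ Λ(∅)^(K-1)` for colourings of the arc-starts; this is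
proved by induction on the number of colour changes (part 4): one of two adjacent LIGHT runs `X`, `Y` (`|X|+|Y| ≤ 2k+1`, `|Y| ≤ k`,
part 2b) is recoloured with the other's colour, which does not decrease the product by FACT 1/2 (part 2a) and the INTERVAL MERGING
LEMMA `w(X)·w(Y) ≤ Λ(∅)·z(X,Y)` (part 3: an explicit weight-preserving injection `Φ : W_X × W_Y → A × Z_{XY}`).

THIS FILE.  `IsChange c t` (colour change at `t`), `exists_change_of_ne`, the run length `nxt c t` after a start and its calculus
(`colour_stretch`, `isChange_sh_nxt`, `nxt_le_fd`, `nxt_lt`, `two_colours_of_cover`), and **`exists_light_change`**: if three colours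
occur, some change `t` is followed by runs of lengths `l₁, l₂` with `l₁ + l₂ ≤ 2k+1` and `l₂ ≤ k`; `ivl_shift`.
-/

noncomputable section

namespace Summit.CriticalPhenomena.PercolationContinuityZ3.Theorems.SunflowerPartition

namespace SafeCalc

open Finset
open TwoGenCore (wmiss)

namespace Arc

variable {k : ℕ}

/-! ## Colourings of the starts: colour changes, run lengths, and the existence of a light pair of adjacent runs -/

section Changes

variable {K : ℕ} (c : Fin (3 * k + 2) → Fin K)

/-- `t` is a COLOUR CHANGE if its successor has a different colour. [this work] -/
def IsChange (t : Fin (3 * k + 2)) : Prop := c t ≠ c (sh t 1)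

/-- `IsChange` is decidable. -/
instance decIsChange : DecidablePred (IsChange (k := k) c) := fun t => inferInstanceAs (Decidable (c t ≠ c (sh t 1)))

/-- Two starts of different colours force a colour change (walk from one to the other). [this work] -/
theorem exists_change_of_ne {u v : Fin (3 * k + 2)} (h : c u ≠ c v) : ∃ t, IsChange c t := by
  have key : ∀ d (u : Fin (3 * k + 2)), fd u v = d → c u ≠ c v → ∃ t, IsChange c t := by
    intro d
    induction d with
    | zero => intro u hd h; rw [fd_eq_zero_iff] at hd; exact absurd (congrArg c hd) h
    | succ d ih =>
      intro u hd h
      by_cases h1 : IsChange c u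
      · exact ⟨u, h1⟩
      · unfold IsChange at h1; rw [not_not] at h1
        refine ih (sh u 1) ?_ (by rwa [← h1])
        have h1N : 1 < 3 * k + 2 := by omega
        have := fd_sub (show fd u (sh u 1) ≤ fd u v by rw [fd_sh u h1N, hd]; omega)
        rw [this, fd_sh u h1N, hd]; omega
  exact key _ u rfl h

/-- The length of the maximal monochromatic stretch after `t`: the least `m ≥ 1` such that `sh t m` is a change (or `3k+2`).
[this work] -/
def nxt (t : Fin (3 * k + 2)) : ℕ :=
  Nat.find (⟨3 * k + 2, by omega, Or.inr rfl⟩ : ∃ m, 1 ≤ m ∧ (IsChange c (sh t m) ∨ m = 3 * k + 2))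

/-- Specification of `nxt`. -/
theorem nxt_spec (t : Fin (3 * k + 2)) : 1 ≤ nxt c t ∧ (IsChange c (sh t (nxt c t)) ∨ nxt c t = 3 * k + 2) :=
  Nat.find_spec (⟨3 * k + 2, by omega, Or.inr rfl⟩ : ∃ m, 1 ≤ m ∧ (IsChange c (sh t m) ∨ m = 3 * k + 2))

/-- `nxt ≤ 3k+2`. -/
theorem nxt_le (t : Fin (3 * k + 2)) : nxt c t ≤ 3 * k + 2 :=
  Nat.find_le ⟨by omega, Or.inr rfl⟩

/-- `1 ≤ nxt`. -/
theorem one_le_nxt (t : Fin (3 * k + 2)) : 1 ≤ nxt c t := (nxt_spec c t).1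

/-- No change strictly inside the stretch. -/
theorem not_isChange_of_lt_nxt (t : Fin (3 * k + 2)) {m : ℕ} (h1 : 1 ≤ m) (hm : m < nxt c t) : ¬ IsChange c (sh t m) := by
  have := Nat.find_min (⟨3 * k + 2, by omega, Or.inr rfl⟩ : ∃ m, 1 ≤ m ∧ (IsChange c (sh t m) ∨ m = 3 * k + 2)) hm
  intro h; exact this ⟨h1, Or.inl h⟩

/-- After a change, the stretch ends at a change. -/
theorem isChange_sh_nxt {t : Fin (3 * k + 2)} (ht : IsChange c t) : IsChange c (sh t (nxt c t)) := by
  rcases (nxt_spec c t).2 with h | h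
  · exact h
  · rw [h, sh_n]; exact ht

/-- The stretch is monochromatic: `c (sh t m) = c (sh t 1)` for `1 ≤ m ≤ nxt c t`. [this work] -/
theorem colour_stretch (t : Fin (3 * k + 2)) {m : ℕ} (h1 : 1 ≤ m) (hm : m ≤ nxt c t) : c (sh t m) = c (sh t 1) := by
  induction m with
  | zero => omega
  | succ m ih =>
    rcases Nat.eq_zero_or_pos m with rfl | hpos
    · rfl
    · have h := not_isChange_of_lt_nxt c t hpos (by omega)
      unfold IsChange at h; rw [not_not, sh_sh] at h
      rw [← h]; exact ih hpos (by omega)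

/-- K1: another change is at forward distance at least `nxt`. [this work] -/
theorem nxt_le_fd {t t' : Fin (3 * k + 2)} (ht' : IsChange c t') (hne : t' ≠ t) : nxt c t ≤ fd t t' := by
  by_contra h
  push Not at h
  have h1 : 1 ≤ fd t t' := by
    rcases Nat.eq_zero_or_pos (fd t t') with h0 | h0
    · exact absurd (fd_eq_zero_iff.1 h0).symm hne
    · exact h0
  have := not_isChange_of_lt_nxt c t h1 h
  rw [sh_fd] at this
  exact this ht'

/-- If two colours occur then every stretch is proper: `nxt c t < 3k+2`. [this work] -/
theorem nxt_lt (h2 : ∃ u v, c u ≠ c v) (t : Fin (3 * k + 2)) : nxt c t < 3 * k + 2 := by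
  by_contra h
  have hN : nxt c t = 3 * k + 2 := le_antisymm (nxt_le c t) (not_lt.1 h)
  obtain ⟨u, v, huv⟩ := h2
  have hall : ∀ x, c x = c (sh t 1) := by
    intro x
    rcases Nat.eq_zero_or_pos (fd t x) with h0 | h0
    · rw [fd_eq_zero_iff] at h0
      rw [← h0, ← colour_stretch c t (show 1 ≤ 3 * k + 2 by omega) (by rw [hN]), sh_n]
    · rw [← sh_fd t x]
      exact colour_stretch c t h0 (by rw [hN]; exact (fd_lt t x).le)
  exact huv (by rw [hall u, hall v])

/-- Covering by two consecutive stretches that close up: if `t₂ = sh t₁ (nxt t₁)` and `nxt t₁ + nxt t₂ = 3k+2` then only two colours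
occur. [this work] -/
theorem two_colours_of_cover {t₁ : Fin (3 * k + 2)} (hsum : nxt c t₁ + nxt c (sh t₁ (nxt c t₁)) = 3 * k + 2)
    (x : Fin (3 * k + 2)) : c x = c (sh t₁ 1) ∨ c x = c (sh (sh t₁ (nxt c t₁)) 1) := by
  set l1 := nxt c t₁ with hl1
  set t₂ := sh t₁ l1 with ht₂
  rcases Nat.eq_zero_or_pos (fd t₁ x) with h0 | h0
  · -- `x = t₁ = sh t₂ (nxt t₂)`
    right
    rw [fd_eq_zero_iff] at h0
    have : x = sh t₂ (nxt c t₂) := by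
      rw [← h0, ht₂, sh_sh, hsum, sh_n]
    rw [this]
    exact colour_stretch c t₂ (one_le_nxt c t₂) le_rfl
  · by_cases hm : fd t₁ x ≤ l1
    · left; rw [← sh_fd t₁ x]; exact colour_stretch c t₁ h0 hm
    · right
      push Not at hm
      have e : x = sh t₂ (fd t₁ x - l1) := by
        rw [ht₂, sh_sh, show l1 + (fd t₁ x - l1) = fd t₁ x by omega, sh_fd]
      rw [e]
      have := fd_lt t₁ x
      exact colour_stretch c t₂ (by omega) (by omega)

/-- **A light pair of adjacent runs exists** as soon as three colours occur: some change `t` has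
`nxt t + nxt t' ≤ 2k+1` and `nxt t' ≤ k` for the next change `t' = sh t (nxt t)` (the run after `t` and the run after `t'` have total
length `≤ 2k+1`, the second one length `≤ k`).  (Follow five consecutive runs from any change: if every consecutive pair were heavy or
had a long second member, their lengths could not fit into the `3k+2` starts.) [this work] -/
theorem exists_light_change (h3 : ∃ u v w, c u ≠ c v ∧ c v ≠ c w ∧ c u ≠ c w) :
    ∃ t, IsChange c t ∧ nxt c t + nxt c (sh t (nxt c t)) ≤ 2 * k + 1 ∧ nxt c (sh t (nxt c t)) ≤ k := by
  obtain ⟨u, v, w, huv, hvw, huw⟩ := h3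
  have h2 : ∃ u v, c u ≠ c v := ⟨u, v, huv⟩
  obtain ⟨t₁, ht₁⟩ := exists_change_of_ne c huv
  by_contra H
  push Not at H
  -- the chain of changes t₁ → t₂ → t₃ → t₄ → t₅ and the run lengths l1 … l5
  set l1 := nxt c t₁ with hl1
  set t₂ := sh t₁ l1 with ht₂
  have ht₂c : IsChange c t₂ := isChange_sh_nxt c ht₁
  set l2 := nxt c t₂ with hl2
  set t₃ := sh t₂ l2 with ht₃
  have ht₃c : IsChange c t₃ := isChange_sh_nxt c ht₂c
  set l3 := nxt c t₃ with hl3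
  set t₄ := sh t₃ l3 with ht₄
  have ht₄c : IsChange c t₄ := isChange_sh_nxt c ht₃c
  set l4 := nxt c t₄ with hl4
  set t₅ := sh t₄ l4 with ht₅
  have ht₅c : IsChange c t₅ := isChange_sh_nxt c ht₄c
  set l5 := nxt c t₅ with hl5
  have H1 : 2 * k + 2 ≤ l1 + l2 ∨ k + 1 ≤ l2 := by
    have := H t₁ ht₁; rw [← hl1, ← ht₂, ← hl2] at this
    by_contra h; push Not at h; have := this (by omega); omega
  have H2 : 2 * k + 2 ≤ l2 + l3 ∨ k + 1 ≤ l3 := by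
    have := H t₂ ht₂c; rw [← hl2, ← ht₃, ← hl3] at this
    by_contra h; push Not at h; have := this (by omega); omega
  have H3 : 2 * k + 2 ≤ l3 + l4 ∨ k + 1 ≤ l4 := by
    have := H t₃ ht₃c; rw [← hl3, ← ht₄, ← hl4] at this
    by_contra h; push Not at h; have := this (by omega); omega
  have H4 : 2 * k + 2 ≤ l4 + l5 ∨ k + 1 ≤ l5 := by
    have := H t₄ ht₄c; rw [← hl4, ← ht₅, ← hl5] at this
    by_contra h; push Not at h; have := this (by omega); omega
  have hl1N : l1 < 3 * k + 2 := nxt_lt c h2 t₁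
  have hl1p : 1 ≤ l1 := one_le_nxt c t₁
  have hl2p : 1 ≤ l2 := one_le_nxt c t₂
  have hl3p : 1 ≤ l3 := one_le_nxt c t₃
  have hl4p : 1 ≤ l4 := one_le_nxt c t₄
  -- distances from t₁ and the K1 bounds
  have e12 : fd t₁ t₂ = l1 := by rw [ht₂, fd_sh t₁ hl1N]
  have hne21 : t₂ ≠ t₁ := by intro h; rw [h, fd_self] at e12; omega
  have K12 : l2 ≤ fd t₂ t₁ := nxt_le_fd c ht₁ hne21.symm
  rw [fd_rev_eq hne21.symm, e12] at K12
  -- if the first two stretches close up, only two colours occur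
  have hlt12 : l1 + l2 < 3 * k + 2 := by
    by_contra h
    have hsum : nxt c t₁ + nxt c (sh t₁ (nxt c t₁)) = 3 * k + 2 := by rw [← hl1, ← ht₂, ← hl2]; omega
    have hc := two_colours_of_cover c hsum
    rcases hc u with hu | hu <;> rcases hc v with hv | hv <;> rcases hc w with hw | hw
    all_goals first
      | exact huv (hu.trans hv.symm) | exact hvw (hv.trans hw.symm) | exact huw (hu.trans hw.symm)
  have e13 : fd t₁ t₃ = l1 + l2 := by rw [ht₃, ht₂, sh_sh, fd_sh t₁ hlt12]
  have hne31 : t₃ ≠ t₁ := by intro h; rw [h, fd_self] at e13; omega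
  have K13 : l3 ≤ fd t₃ t₁ := nxt_le_fd c ht₁ hne31.symm
  rw [fd_rev_eq hne31.symm, e13] at K13
  by_cases h123 : l1 + l2 + l3 = 3 * k + 2
  · -- three runs: t₄ = t₁, l4 = l1
    have ht41 : t₄ = t₁ := by rw [ht₄, ht₃, ht₂, sh_sh, sh_sh, show l1 + (l2 + l3) = 3 * k + 2 by omega, sh_n]
    have : l4 = l1 := by rw [hl4, ht41]
    omega
  have hlt123 : l1 + l2 + l3 < 3 * k + 2 := by omega
  have e14 : fd t₁ t₄ = l1 + l2 + l3 := by
    rw [ht₄, ht₃, ht₂, sh_sh, sh_sh, show l1 + (l2 + l3) = l1 + l2 + l3 by omega, fd_sh t₁ hlt123]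
  have hne41 : t₄ ≠ t₁ := by intro h; rw [h, fd_self] at e14; omega
  have K14 : l4 ≤ fd t₄ t₁ := nxt_le_fd c ht₁ hne41.symm
  rw [fd_rev_eq hne41.symm, e14] at K14
  by_cases h1234 : l1 + l2 + l3 + l4 = 3 * k + 2
  · -- four runs: t₅ = t₁, l5 = l1
    have ht51 : t₅ = t₁ := by
      rw [ht₅, ht₄, ht₃, ht₂, sh_sh, sh_sh, sh_sh, show l1 + (l2 + (l3 + l4)) = 3 * k + 2 by omega, sh_n]
    have : l5 = l1 := by rw [hl5, ht51]
    omega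
  have hlt1234 : l1 + l2 + l3 + l4 < 3 * k + 2 := by omega
  have e15 : fd t₁ t₅ = l1 + l2 + l3 + l4 := by
    rw [ht₅, ht₄, ht₃, ht₂, sh_sh, sh_sh, sh_sh, show l1 + (l2 + (l3 + l4)) = l1 + l2 + l3 + l4 by omega,
      fd_sh t₁ hlt1234]
  have hne51 : t₅ ≠ t₁ := by intro h; rw [h, fd_self] at e15; omega
  have K15 : l5 ≤ fd t₅ t₁ := nxt_le_fd c ht₁ hne51.symm
  rw [fd_rev_eq hne51.symm, e15] at K15
  omega

/-- Shifting the origin of an interval sitting after it: `ivl t (a+1) (a+b) = ivl (sh t a) 1 b` when `a + b < 3k+2`. [this work] -/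
theorem ivl_shift (t : Fin (3 * k + 2)) {a b : ℕ} (hab : a + b < 3 * k + 2) :
    ivl t (a + 1) (a + b) = ivl (sh t a) 1 b := by
  ext x
  rw [mem_ivl, mem_ivl]
  have ea : fd t (sh t a) = a := fd_sh t (by omega)
  constructor
  · rintro ⟨h1, h2⟩
    rw [fd_sub (show fd t (sh t a) ≤ fd t x by rw [ea]; omega), ea]
    omega
  · rintro ⟨h1, h2⟩
    have hsum : fd t (sh t a) + fd (sh t a) x < 3 * k + 2 := by rw [ea]; omega
    have := fd_add_fd hsum
    rw [ea] at this
    omega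

end Changes

end Arc

end SafeCalc

end Summit.CriticalPhenomena.PercolationContinuityZ3.Theorems.SunflowerPartition
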